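import Summits.AnomalousDissipation.AnomalousDissipation.Theorems.SolenoidalFractalHomogenisationLagrangianStepCellChainSetup
import Summits.AnomalousDissipation.AnomalousDissipation.Theorems.SolenoidalFractalHomogenisationLagrangianStepCellChainEnergyFrame
import Summits.AnomalousDissipation.AnomalousDissipation.Theorems.SolenoidalFractalHomogenisationLagrangianStepCellChainClassPairFrame
import Summits.AnomalousDissipation.AnomalousDissipation.Theorems.SolenoidalFractalHomogenisationLagrangianStepCellChainModesFrame
import HarnessLib

/-!
# K1L_D (stmt-AnomalousDissipation-27980), (ℓ3) (D-TH)₀ — SET-UP OF THE FROZEN-FRAME MODE CALCULUS FROM THE BINDERS OF `ClassDecayWθ`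
# (helper; `--supports stmt-AnomalousDissipation-27980 --as helper`)

Port plan B6 (`HOME/ad-sawtooth-k1loc-p1/g16/W7thg-portplan-k1locp1g16.md`; prover ad-sawtooth-k1loc-p1 g16): the frozen-frame twin of
`CellChain.classDecayW_setup` (`…CellChainSetup`, w1 g4).  From the binders of `ClassDecayWθ G₀ …` (`…OneLevelSplitDefsW7Frame`, p728917) at a CONSTANT
non-degenerate frame (`c₀|k|² ≤ |G₀ᵀk|²`, `0 < c₀`): (a) the lam-free Legendre–Hadamard window of the weak tensor `(1/n²)𝔸` (flat lemma
`nearIso_weakTensor_of_window`, reused); (b) `F ∈ L² ∩ L¹` and `G₀F` weakly divergence free; (c) the ENERGY PACKAGE of the frozen solution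
(`CellChain.exists_energyRep_cell_frame`, w1 g9: `E`, `Q`, continuity, antitonicity, a.e. derivative `−2Q`, the TWISTED symbol dissipation
`4π² Σ Re⟪û, T_{𝔸^{G₀}} û⟫ ≤ Q` and its per-mode coercivity `lo'·c₀·|k|²‖û(k)‖² ≤ Re⟪û,T û⟫`); (d) CLASS-PAIR CONFINEMENT
(`ae_modes_vanish_off_classPair_frame`, p729001, through `Literature/…ConstFrameSymmetry`); (e) the a.e. identification of the modes with the twisted
representatives `modeRepθ` (`ae_forall_eq_modeRepθ`, w1 g9).
* `classDecayWθ_setup`.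
No definitions, no sorry.  NOT a proof of `stub_W7thg`, of K1L_D or of AD; rung F-D1.A0.
[cite: Temam1984, Ch. III §1 Lemma 1.2 (energy inequality)] [cite: KhaKuchment2021, §1.1–§1.2 (G-periodic operators, γ_k-automorphic functions)] [problem: turb]
-/

set_option linter.dupNamespace false

noncomputable section

namespace Summit.AnomalousDissipation.AnomalousDissipation.Theorems.SolenoidalFractalHomogenisation.LagrangianStep.CellChain

open Set MeasureTheory Filter Topology Function Complex UnitAddTorus
open scoped InnerProductSpace ENNReal
open Literature.Analysis Literature.Analysis.FunctionSpaces Literature.Analysis.FunctionSpaces.Torus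
open Literature.Analysis.FluidPDE Literature.Analysis.FluidPDE.LatticeShear
open Summit.AnomalousDissipation.AnomalousDissipation.Theorems.SolenoidalFractalHomogenisation.RealisedQuasiStaticCellLaw
open Summit.AnomalousDissipation.AnomalousDissipation.Theorems.SolenoidalFractalHomogenisation.LagrangianStep

/-- **SET-UP OF THE FROZEN-FRAME MODE CALCULUS FROM THE BINDERS OF `ClassDecayWθ`.**  See the module docstring for the five outputs (a)–(e).
[cite: Temam1984, Ch. III §1 Lemma 1.2 (energy inequality)] [cite: KhaKuchment2021, §1.1–§1.2 (G-periodic operators, γ_k-automorphic functions)] -/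
theorem classDecayWθ_setup {k : ℕ} (W : LatticeWord k) (M : ℝ) (hM : 0 < M) {lo hi Λ ν : ℝ} (hlo : 0 < lo) (hhi : 0 ≤ hi) (hΛ : 1 ≤ Λ)
    (hν : 0 < ν) {n : ℕ} (hn : 1 ≤ n) {𝔸 : Torus.Visc4 (Fin 3)}
    (hwin : ∃ lam ∈ Set.Icc (1:ℝ) Λ, Torus.NearIso 𝔸 (ν * (lo / lam)) (ν * (hi * lam)))
    {G₀ : Matrix (Fin 3) (Fin 3) ℝ} {c₀ : ℝ} (hc₀ : 0 < c₀) (hG : ∀ k' : Fin 3 → ℤ, c₀ * freqNormSq k' ≤ ∑ a, Torus.twistFreq G₀ k' a ^ 2)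
    (ℓ : Fin 3 → ℤ) {F : VF} (hF1 : MemSobolev 1 (FunctionSpaces.EuclideanSpace.complexify ∘ F))
    (hF3 : FunctionSpaces.Torus.IsWeaklyDivFree (Torus.distort (fun _ => G₀) F))
    (hsupp : ∀ k' : Fin 3 → ℤ, (¬ ∃ z : Fin 3 → ℤ, k' = ℓ + (n : ℤ) • z) → (¬ ∃ z : Fin 3 → ℤ, k' = -ℓ + (n : ℤ) • z) →
      ∀ i, modeCoeff k' F i = 0)
    {T : ℝ} (hT : 0 < T) {u : ℝ → VF}
    (hu : Torus.IsWeakTensorPassiveVectorDistortedOn 0 T ((1 / (n:ℝ) ^ 2) • 𝔸) (cellField W M hM ν hν n) (fun _ _ => G₀) F u) :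
    Torus.NearIso ((1 / (n:ℝ) ^ 2) • 𝔸) ((1 / (n:ℝ) ^ 2) * (ν * (lo / Λ))) ((1 / (n:ℝ) ^ 2) * (ν * (hi * Λ))) ∧
    (MemLp F 2 volume ∧ Integrable F volume ∧ FunctionSpaces.Torus.IsWeaklyDivFree (Torus.distort (fun _ => G₀) F)) ∧
    (∃ E Q : ℝ → ℝ,
      E 0 = ∫ x, ‖F x‖ ^ 2 ∧
      (∀ t ∈ Icc 0 T, E t = (∫ x, ‖F x‖ ^ 2) - 2 * ∫ s in (0:ℝ)..t, Q s) ∧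
      ContinuousOn E (Icc 0 T) ∧
      AntitoneOn E (Icc 0 T) ∧
      (∀ a ∈ Icc 0 T, ∀ b' ∈ Icc 0 T, AbsolutelyContinuousOnInterval E a b') ∧
      (∀ᵐ t ∂(volume.restrict (Ioo 0 T)), E t = ∫ x, ‖u t x‖ ^ 2) ∧
      IntegrableOn Q (Ioo 0 T) ∧
      (∀ᵐ t ∂(volume.restrict (Ioo 0 T)), 0 ≤ Q t) ∧
      (∀ᵐ t ∂(volume : Measure ℝ), t ∈ Ioo 0 T → HasDerivAt E (-(2 * Q t)) t) ∧
      (∀ᵐ t ∂(volume.restrict (Ioo 0 T)), ∀ S : Finset (Fin 3 → ℤ),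
        4 * Real.pi ^ 2 * ∑ k' ∈ S, (⟪mFourierCoeff (EuclideanSpace.complexify ∘ u t) k',
          Torus.symbT (Torus.Visc4.conj G₀ ((1 / (n:ℝ) ^ 2) • 𝔸)) k' (mFourierCoeff (EuclideanSpace.complexify ∘ u t) k')⟫_ℂ).re ≤ Q t) ∧
      (∀ᵐ t ∂(volume.restrict (Ioo 0 T)), ∀ k' : Fin 3 → ℤ,
        0 ≤ (⟪mFourierCoeff (EuclideanSpace.complexify ∘ u t) k',
          Torus.symbT (Torus.Visc4.conj G₀ ((1 / (n:ℝ) ^ 2) • 𝔸)) k' (mFourierCoeff (EuclideanSpace.complexify ∘ u t) k')⟫_ℂ).re ∧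
        (1 / (n:ℝ) ^ 2) * (ν * (lo / Λ)) * c₀ * (freqNormSq k' * ‖mFourierCoeff (EuclideanSpace.complexify ∘ u t) k'‖ ^ 2) ≤
          (⟪mFourierCoeff (EuclideanSpace.complexify ∘ u t) k',
            Torus.symbT (Torus.Visc4.conj G₀ ((1 / (n:ℝ) ^ 2) • 𝔸)) k' (mFourierCoeff (EuclideanSpace.complexify ∘ u t) k')⟫_ℂ).re)) ∧
    (∀ᵐ t ∂(volume.restrict (Ioo 0 T)), ∀ k' : Fin 3 → ℤ,
      (¬ ∃ z : Fin 3 → ℤ, k' = ℓ + (n : ℤ) • z) → (¬ ∃ z : Fin 3 → ℤ, k' = -ℓ + (n : ℤ) • z) →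
      mFourierCoeff (FunctionSpaces.EuclideanSpace.complexify ∘ u t) k' = 0) ∧
    (∀ᵐ t ∂(volume.restrict (Ioo 0 T)), ∀ k' : Fin 3 → ℤ,
      mFourierCoeff (EuclideanSpace.complexify ∘ u t) k' =
        modeRepθ ((W.stretch M hM).stretch (1 / ν) (one_div_pos.mpr hν)) n ((1 / (n:ℝ) ^ 2) • 𝔸) G₀ F u k' t) := by
  have hn0 : 0 < n := hn
  have hN := nearIso_weakTensor_of_window hlo.le hhi hν.le n hwin
  have hlo' : 0 < (1 / (n:ℝ) ^ 2) * (ν * (lo / Λ)) := by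
    have : (0:ℝ) < n := by exact_mod_cast hn0
    have hΛ0 : 0 < Λ := lt_of_lt_of_le one_pos hΛ
    positivity
  have hF2 : MemLp F 2 volume := memLp_two_of_memSobolev_one_complexify hF1
  have hFi : Integrable F volume := hF2.integrable one_le_two
  refine ⟨hN, ⟨hF2, hFi, hF3⟩, ?_, ?_, ?_⟩
  · have hu' : Torus.IsWeakTensorPassiveVectorDistortedOn 0 T ((1 / (n:ℝ) ^ 2) • 𝔸)
        (((W.stretch M hM).stretch (1 / ν) (one_div_pos.mpr hν)).cell n) (fun _ _ => G₀) F u := by rw [← cellField_eq_cell]; exact hu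
    exact exists_energyRep_cell_frame _ n hT hN hlo' G₀ hc₀ hG hF2 hF3 hu'
  · have hsupp' : ∀ k' : Fin 3 → ℤ, (¬ ∃ z : Fin 3 → ℤ, k' = ℓ + (n : ℤ) • z) → (¬ ∃ z : Fin 3 → ℤ, k' = -ℓ + (n : ℤ) • z) →
        mFourierCoeff (FunctionSpaces.EuclideanSpace.complexify ∘ F) k' = 0 := by
      intro k' h1 h2
      ext i
      rw [← modeCoeff_eq hFi, hsupp k' h1 h2 i]
      rfl
    have hA1 : Torus.NearIso 𝔸 (ν * ((lo / Λ) / 1)) (ν * ((hi * Λ) * 1)) := by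
      obtain ⟨lam, hlam, hA⟩ := hwin
      have hlam1 : 0 < lam := lt_of_lt_of_le one_pos hlam.1
      rw [div_one, mul_one]
      exact hA.mono (mul_le_mul_of_nonneg_left (div_le_div_of_nonneg_left hlo.le hlam1 hlam.2) hν.le)
        (mul_le_mul_of_nonneg_left (mul_le_mul_of_nonneg_left hlam.2 hhi) hν.le)
    exact ae_modes_vanish_off_classPair_frame W M hM (lo := lo / Λ) (hi := hi * Λ) (lam := 1)
      (div_pos hlo (lt_of_lt_of_le one_pos hΛ)) one_pos hν hn0 hA1 hc₀ hG ℓ hF2 hsupp' hu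
  · have hu' : Torus.IsWeakTensorPassiveVectorDistortedOn 0 T ((1 / (n:ℝ) ^ 2) • 𝔸)
        (((W.stretch M hM).stretch (1 / ν) (one_div_pos.mpr hν)).cell n) (fun _ _ => G₀) F u := by rw [← cellField_eq_cell]; exact hu
    exact ae_forall_eq_modeRepθ _ n hT.le hu' hFi

end Summit.AnomalousDissipation.AnomalousDissipation.Theorems.SolenoidalFractalHomogenisation.LagrangianStep.CellChain

end
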